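import Summits.BirchSwinnertonDyer.BirchSwinnertonDyer.Theorems.GenusKolyvaginAtTwoK1PosSuHalvesSwappedLedger
import HarnessLib

/-!
# Route `GenusKolyvaginAtTwo`, crux K₁⁺ `K1Pos` (stmt-BirchSwinnertonDyer-31468), LINE 31 «su_halves»: THE RANK-ONE HALF ON THE (★)-LOCUS FROM
# THE LANDED `t′`-FREE LEDGER — B ⟸ B1′ ((★)-frame for the twin) + B3♯ (`0 ≤ ord₂ #Ш_an(W')`), B2 no longer a stub

Seat `bsd-line-gk2-p3` g32 (PROVER seat 3/3, cell `bsd-f1-sign2`), `--supports stmt-BirchSwinnertonDyer-31468` (helper; closes nothing); sequel of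
`…K1PosSuHalvesSwappedLedger` (p781983).  THEOREMS ONLY (no definition, no named fact, no `sorry`); standard axioms.  **BSD is NOT proved by this
file; K1Pos is NOT proved; no item is closed.**  CONDITIONAL (D-0014) on the route's four STATEMENT-ONLY published facts and on the two displayed
inputs of LINE 31's B-branch — a (★)-frame for the twin (B1′, beyond print) and the rank-zero `2`-integrality of the partner's `#Ш_an` (B3♯, print-type).

* `rankOneHalf_of_starFrame_of_shaAn_integral` — for ANY globally minimal `Wd/ℚ` of analytic rank `1` with `#Sel₂(Wd) = 2`: an auxiliary Heegner frame
  `K'` of `Wd` with an odd-Manin datum `Dt'`, `P' ∈ Wd(K')` under `P(1)`, `j` with Kriz–Li's `AssumptionStar Wd Dt' K' P' j`, `c₂(Wd)` odd (= B1′'s output,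
  WITHOUT its partner-side clauses), a globally minimal `W' ≅ Wd^(d_K')` with `#Ш_an(W') = q'` and `0 ≤ ord₂ q'` (B3♯) ⟹ **`#Ш_an(Wd) = qd`, `ord₂ qd ≤ 0`**
  (LINE 31's B / `stub_rankOneHalf` conclusion).  Proof: (★) ⟹ `P' ∉ 2·Wd(K')` (tree `KrizLi2019.not_exists_two_zsmul_eq_of_assumptionStar`); `2` split
  ⟹ `d_(K')` odd `≠ −3`; `SwappedLedger.swappedLedger_tfree` ⟹ `ord₂ qd + ord₂ q' ≤ −2 ord₂ C(Wd) ≤ 0`.  No sign / Tamagawa / `W'(ℚ)[2]` hypothesis is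
  needed (on K₁⁻ the (★)-frame cannot exist modulo the leaf, `…K1NegSuHalvesStarFrameObstruction`; the statement is then vacuous there).
* `K1Pos.rankOneHalf_of_starFrameSupply_conclusion` — the same consuming B1′'s `∃`-package VERBATIM (LINE 31 `stub_starFrameSupply` conclusion shape)
  plus B3♯ for the partner it names.

References: [KrizLi2019] FMS Thm. 1.12, Lemma 5.4; [GrossZagier1986] V.§2 (2.2); [Milne1972ArithmeticAV] §1 Thm. 1; [Kramer1981] proof of Thm. 2;
[Miller2011LMS] Def. 1.1.
-/

set_option autoImplicit false
set_option linter.dupNamespace false -- `Summit.<P>.<Sub>` repeats `BirchSwinnertonDyer` (D-0017)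

noncomputable section

open scoped Classical

open WeierstrassCurve NumberField Literature.NumberTheory.EllipticCurves Literature.NumberTheory.EllipticCurves.ModularForms
  Literature.NumberTheory.EllipticCurves.Rank1Residual Literature.NumberTheory.EllipticCurves.Rank1Residual.Typed
  Literature.NumberTheory.EllipticCurves.KrizLi2019
  Summit.BirchSwinnertonDyer.Rank1Residual Summit.BirchSwinnertonDyer.Rank1Residual.AdditivePotMult
  Summit.BirchSwinnertonDyer.BirchSwinnertonDyer.Rank1Residual Summit.BirchSwinnertonDyer.BirchSwinnertonDyer.Theses.GenusKolyvaginAtTwo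
  Summit.BirchSwinnertonDyer.BirchSwinnertonDyer.Theorems.CMExactDescent Summit.BirchSwinnertonDyer.BirchSwinnertonDyer.Theorems.GenusExact.TwinSwap

namespace Summit.BirchSwinnertonDyer.BirchSwinnertonDyer.Theorems.GenusExact.SuHalves.SwappedLedger

/-- **The rank-one half on the (★)-locus, from the landed `t′`-free ledger.**  `Wd/ℚ` globally minimal of analytic rank `1` with `#Sel₂(Wd) = 2`; `K'` imaginary
quadratic, Heegner for `N(Wd)`; `Dt'` with odd `Dt'.c`; `d₁'`; `P' ∈ Wd(K')` mapping to `d₁'.derivedPoint`; `j : K' → ℚ₂` with `AssumptionStar Wd Dt' K' P' j`;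
`c₂(Wd)` odd; `W'` a globally minimal model of `Wd^(d_K')` with `#Ш_an(W') = q'` and `0 ≤ ord₂ q'`.  Then, modulo the four PRINT facts, `#Ш_an(Wd) = qd ∈ ℚ`
with **`ord₂ qd ≤ 0`**.  CONDITIONAL on the displayed hypotheses; nothing about BSD is proved.
[cite: KrizLi2019, Lemma 5.4 (FMS)] [cite: GrossZagier1986, V.§2 (2.2)] [cite: Milne1972ArithmeticAV, §1 Thm. 1] [cite: Kramer1981, proof of Thm. 2] -/
theorem rankOneHalf_of_starFrame_of_shaAn_integral
    (hGZ : GrossZagierAllLevels) (hL : EntireLFunctionRat) (hGZK : MultPublishedInputsAtTwo) (hMi : MilneAnyModel)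
    (Wd : WeierstrassCurve ℚ) [Wd.IsElliptic] [Wd.IsGloballyMinimal] [NeZero (Wd.conductorNorm ℤ)]
    (hrd : Wd.analyticRank = 1) (hSel : Nat.card (Wd.selmerGroup 2) = 2)
    (K' : Type) [Field K'] [NumberField K'] (hIQ' : IsImaginaryQuadratic K') (hHe' : SatisfiesHeegnerHypothesis (Wd.conductorNorm ℤ) K')
    (Dt' : ModularParametrizationData Wd (Wd.conductorNorm ℤ)) (hc' : Odd Dt'.c)
    (β' : ℤ) (ι' : K' →+* ℂ) (d₁' : KolyvaginHeegnerData Dt' β' ι' 1)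
    (P' : (Wd.baseChange K').toAffine.Point)
    (hP' : WeierstrassCurve.Affine.Point.map (W' := Wd) (algebraMap K' (ringClassField K' ι' 1)).toRatAlgHom P' = d₁'.derivedPoint)
    (j : K' →ₐ[ℚ] ℚ_[2]) (hstar : AssumptionStar Wd Dt' K' P' j)
    (hc2 : haveI : Fact (Nat.Prime 2) := ⟨Nat.prime_two⟩; Odd ((Wd.baseChange ℚ_[2]).localTamagawaNumber ℤ_[2]))
    (W' : WeierstrassCurve ℚ) [W'.IsElliptic] [W'.IsGloballyMinimal]
    (hW' : ∃ C : VariableChange ℚ, C • Wd.quadraticTwist (NumberField.discr K' : ℚ) = W')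
    (q' : ℚ) (hq' : shaAn W' = (q' : ℂ)) (hB3 : 0 ≤ padicValRat 2 q') :
    ∃ qd : ℚ, shaAn Wd = (qd : ℂ) ∧ padicValRat 2 qd ≤ 0 := by
  haveI : Fact (Nat.Prime 2) := ⟨Nat.prime_two⟩
  obtain ⟨hodd', h3'⟩ := StarObstruction.odd_discr_and_ne_neg_three_of_split_two K' hIQ'.1 hstar.1
  -- (★) ⟹ `P' ∉ 2·Wd(K')` (Kriz–Li Lemma 5.4, tree theorem)
  have hnd : ¬ ∃ Q : (Wd.baseChange K').toAffine.Point, (2 : ℤ) • Q = P' :=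
    not_exists_two_zsmul_eq_of_assumptionStar Wd Dt' K' P' j hstar hc2 hc'
  obtain ⟨qd, hqd, hle⟩ := swappedLedger_tfree Wd K' (hGZ _ Wd K') hGZK hL hMi hrd hSel hIQ' hodd' h3' hHe' Dt' hc' β' ι' d₁' P' hP' hnd W'
    hW' q' hq'
  have h0 : (0 : ℤ) ≤ (padicValNat 2 Wd.tamagawaProduct : ℤ) := by positivity
  exact ⟨qd, hqd, by linarith⟩

/-- **LINE 31's rank-one half from B1′'s `∃`-package (text shape of `stub_starFrameSupply`'s conclusion) + B3♯ for the named partner.**  For a globally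
minimal `Wd` of analytic rank `1` with `#Sel₂(Wd) = 2`: B1′'s conclusion (some `K'`, `Dt'`, `d₁'`, `P'`, `j` with (★), `c₂(Wd)` odd, and a globally minimal
rank-`0` partner `W'` without rational `2`-torsion) together with «for THAT partner, `#Ш_an(W') = q'` is `2`-integral» gives `ord₂ #Ш_an(Wd) ≤ 0`.  So in a
v1.4 of LINE 31 the B-branch reads B ⟸ B1′ + B3♯, with B2 discharged by `swappedLedger_tfree`.  CONDITIONAL on the displayed hypotheses; nothing about
BSD is proved. [cite: KrizLi2019, Thm. 1.12 and Lemma 5.4 (FMS)] [cite: GrossZagier1986, V.§2 (2.2)] -/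
theorem K1Pos.rankOneHalf_of_starFrameSupply_conclusion
    (hGZ : GrossZagierAllLevels) (hL : EntireLFunctionRat) (hGZK : MultPublishedInputsAtTwo) (hMi : MilneAnyModel)
    (Wd : WeierstrassCurve ℚ) [Wd.IsElliptic] [Wd.IsGloballyMinimal] [NeZero (Wd.conductorNorm ℤ)]
    (hrd : Wd.analyticRank = 1) (hSel : Nat.card (Wd.selmerGroup 2) = 2)
    (hB1out : ∃ (K' : Type) (_ : Field K') (_ : NumberField K'), IsImaginaryQuadratic K' ∧
      SatisfiesHeegnerHypothesis (Wd.conductorNorm ℤ) K' ∧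
      ∃ (Dt' : ModularParametrizationData Wd (Wd.conductorNorm ℤ)), Odd Dt'.c ∧
      ∃ (β' : ℤ) (ι' : K' →+* ℂ) (d₁' : KolyvaginHeegnerData Dt' β' ι' 1) (P' : (Wd.baseChange K').toAffine.Point)
        (j : K' →ₐ[ℚ] ℚ_[2]),
        WeierstrassCurve.Affine.Point.map (algebraMap K' (ringClassField K' ι' 1)).toRatAlgHom P' = d₁'.derivedPoint ∧
        AssumptionStar Wd Dt' K' P' j ∧
        (haveI : Fact (Nat.Prime 2) := ⟨Nat.prime_two⟩; Odd ((Wd.baseChange ℚ_[2]).localTamagawaNumber ℤ_[2])) ∧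
      ∃ (W' : WeierstrassCurve ℚ) (_ : W'.IsElliptic) (_ : W'.IsGloballyMinimal),
        (∃ C : VariableChange ℚ, C • Wd.quadraticTwist (NumberField.discr K' : ℚ) = W') ∧
        W'.analyticRank = 0 ∧ (∀ Q : W'.toAffine.Point, 2 • Q = 0 → Q = 0) ∧
        ∃ q' : ℚ, shaAn W' = (q' : ℂ) ∧ 0 ≤ padicValRat 2 q') :
    ∃ qd : ℚ, shaAn Wd = (qd : ℂ) ∧ padicValRat 2 qd ≤ 0 := by
  obtain ⟨K', _, _, hIQ', hHe', Dt', hc', β', ι', d₁', P', j, hP', hstar, hc2, W', _, _, hW', -, -, q', hq', hB3⟩ := hB1out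
  exact rankOneHalf_of_starFrame_of_shaAn_integral hGZ hL hGZK hMi Wd hrd hSel K' hIQ' hHe' Dt' hc' β' ι' d₁' P' hP' j hstar hc2 W' hW' q' hq' hB3

end Summit.BirchSwinnertonDyer.BirchSwinnertonDyer.Theorems.GenusExact.SuHalves.SwappedLedger

end
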